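import Summits.QuantumFields.GaugeBoot.Targets
import Literature.MathematicalPhysics.QuantumFieldTheory.WilsonSiteRPForm
import Literature.MathematicalPhysics.QuantumFieldTheory.TorusLoopLinkRP
import HarnessLib

/-!
# Gauge-boot: lattice symmetries and the orbit-average corollary (A2)

Cell `pub-gaugeboot`, task L0, file 3/4 (theorems only; imports `Targets`).

HONEST FRAMING (page 1 of every file of this cell): certified bounds on lattice expectations at
STATED coupling, gauge group, dimension and torus size; NOT a mass gap, NOT a continuum limit,
NOT a string tension, NOT large `N`. The venture is explicitly NOT Yang–Mills-summit-bearing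
(barriers `FixedCouplingUltralocality`, `PerturbativeInvisibility`: fixed-coupling ultralocal data
say nothing about `a → 0`).

The certified object of the venture is the ORBIT-AVERAGED plaquette / Wilson loop (SCOPING A2): the
average of `u_P(x, i, j)` over the symmetry group of the torus, translations ⋉ hyperoctahedral group
`B_d`. Loop-equation rows and Gram blocks among orbit averages are sound by averaging exact identities /
PSD matrices; reflection-positivity blocks in every axis and position need the INVARIANCE of the torus
Wilson state under the lattice automorphisms. All three generators are PROVED in the tree and are only
collected here:
* translations — `wilsonExpectation_comp_torusConfigShift` (`LatticeGaugeProofs`);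
* axis permutations — `wilsonExpectation_comp_configPerm` (`LatticeGaugeStaticPotentialProofs`);
* the reflection `x₀ ↦ -x₀` through lattice hyperplanes — product Haar measure and the plaquette sum
  are invariant (`WilsonSiteRP.measurePreserving_negReflect`, `WilsonSiteRP.plaqRe_negReflect`; the tree
  packages this for even `L` in `WilsonSiteRPForm`); assembled here for EVERY torus side as
  `wilsonExpectation_comp_negReflect`;
together they generate translations ⋉ `B_d` (a reflection of axis `k` is the conjugate of the axis-`0`
reflection by the transposition `(0 k)`).

Proved here: equivariance of `plaquetteTrace` / `wilsonLoop` under translations and axis permutations,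
`2`-transitivity of the axis permutations on ordered pairs, hence
`⟨u_P(y, i', j')⟩ = ⟨u_P(x, i, j)⟩` and `⟨W_{R×T}(y; i', j')⟩ = ⟨W_{R×T}(x; i, j)⟩` for all base points and
ordered pairs of distinct axes, and the **orbit-average corollaries** `⟨ū_P⟩ = ⟨u_P(x, i, j)⟩`,
`⟨W̄(R×T)⟩ = ⟨W_{R×T}(x; i, j)⟩` (`wilsonExpectation_meanPlaquette_eq_plaquetteTrace`,
`wilsonExpectation_meanWilsonLoop_eq_wilsonLoop`); for certified windows: `PlaquetteWindow.plaquetteTrace_mem`,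
`WilsonLoopWindow.wilsonLoop_mem`.
-/

noncomputable section

open MeasureTheory Filter Topology
open Literature.MathematicalPhysics.QuantumFieldTheory
open Literature.MathematicalPhysics.QuantumLattice (fundamentalRep continuous_fundamentalRep
  LGConfig plaquetteObs plaquetteHolonomyZd torusLift toTorusObservable IsCylinder
  IsInfiniteVolumeLimitAlong torusLogPartition)
open Literature.RepresentationTheory.CompactGroups

namespace Summit.QuantumFields.GaugeBoot

section Symmetry

variable {d L N : ℕ} {G : Type*} [Group G] [TopologicalSpace G] [IsTopologicalGroup G]
  [CompactSpace G] [MeasurableSpace G] [BorelSpace G] (ρ : G →* Matrix (Fin N) (Fin N) ℂ)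

open TorusTranslation

omit [TopologicalSpace G] [IsTopologicalGroup G] [CompactSpace G] [BorelSpace G] in
/-- `u_P` of a translated configuration is `u_P` at the translated site. [folklore] -/
theorem plaquetteTrace_torusConfigShift (v x : Site d L) (i j : Fin d) (U : GaugeConfig d L G) :
    plaquetteTrace ρ x i j (torusConfigShift v U) = plaquetteTrace ρ (x - v) i j U := by
  simp only [plaquetteTrace, plaquetteHolonomy_torusConfigShift]

omit [TopologicalSpace G] [IsTopologicalGroup G] [CompactSpace G] [BorelSpace G] in
/-- `u_P` of an axis-permuted configuration is `u_P` of the permuted plaquette. [folklore] -/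
theorem plaquetteTrace_configPerm (π : Equiv.Perm (Fin d)) (x : Site d L) (i j : Fin d)
    (U : GaugeConfig d L G) :
    plaquetteTrace ρ x i j (configPerm π U) =
      plaquetteTrace ρ (sitePerm π.symm x) (π.symm i) (π.symm j) U := by
  simp only [plaquetteTrace, plaquetteHolonomy_configPerm]

omit [TopologicalSpace G] [IsTopologicalGroup G] [CompactSpace G] [BorelSpace G] in
/-- Straight lines of an axis-permuted configuration. [folklore] -/
theorem lineHolonomy_configPerm (π : Equiv.Perm (Fin d)) (U : GaugeConfig d L G) (k : Fin d) :
    ∀ (n : ℕ) (y : Site d L), lineHolonomy (configPerm π U) k n y =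
      lineHolonomy U (π.symm k) n (sitePerm π.symm y)
  | 0, y => by simp [lineHolonomy]
  | n + 1, y => by
    rw [lineHolonomy, lineHolonomy, lineHolonomy_configPerm π U k n, configPerm_apply, sitePerm_shift]

omit [TopologicalSpace G] [IsTopologicalGroup G] [CompactSpace G] [BorelSpace G] in
/-- Rectangles of an axis-permuted configuration. [folklore] -/
theorem rectangleHolonomy_configPerm (π : Equiv.Perm (Fin d)) (U : GaugeConfig d L G) (x : Site d L)
    (i j : Fin d) (R T : ℕ) :
    rectangleHolonomy (configPerm π U) x i j R T =
      rectangleHolonomy U (sitePerm π.symm x) (π.symm i) (π.symm j) R T := by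
  simp only [rectangleHolonomy, lineHolonomy_configPerm, sitePerm_add, sitePerm_single]

omit [TopologicalSpace G] [IsTopologicalGroup G] [CompactSpace G] [BorelSpace G] in
/-- `W_{R×T}` of a translated configuration. [folklore] -/
theorem wilsonLoop_torusConfigShift (v x : Site d L) (i j : Fin d) (R T : ℕ) (U : GaugeConfig d L G) :
    wilsonLoop ρ x i j R T (torusConfigShift v U) = wilsonLoop ρ (x - v) i j R T U := by
  simp only [wilsonLoop, WilsonLoopRP.rectangleHolonomy_torusConfigShift]

omit [TopologicalSpace G] [IsTopologicalGroup G] [CompactSpace G] [BorelSpace G] in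
/-- `W_{R×T}` of an axis-permuted configuration. [folklore] -/
theorem wilsonLoop_configPerm (π : Equiv.Perm (Fin d)) (x : Site d L) (i j : Fin d) (R T : ℕ)
    (U : GaugeConfig d L G) :
    wilsonLoop ρ x i j R T (configPerm π U) =
      wilsonLoop ρ (sitePerm π.symm x) (π.symm i) (π.symm j) R T U := by
  simp only [wilsonLoop, rectangleHolonomy_configPerm]

/-- The hyperoctahedral group is `2`-transitive on axes: any ordered pair of distinct axes is the
image of any other under a permutation (two transpositions). [folklore] -/
theorem exists_perm_apply_eq {i j i' j' : Fin d} (hij : i ≠ j) (hij' : i' ≠ j') :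
    ∃ π : Equiv.Perm (Fin d), π i' = i ∧ π j' = j := by
  refine ⟨Equiv.swap (Equiv.swap i' i j') j * Equiv.swap i' i, ?_, ?_⟩
  · rw [Equiv.Perm.mul_apply, Equiv.swap_apply_left]
    refine Equiv.swap_apply_of_ne_of_ne ?_ hij
    intro h
    have : j' = i' := (Equiv.swap i' i).injective (by rw [← h, Equiv.swap_apply_left])
    exact hij' this.symm
  · rw [Equiv.Perm.mul_apply, Equiv.swap_apply_left]
variable [NeZero L]

/-- **`⟨u_P(x,i,j)⟩` does not depend on the plaquette** (translation and axis-permutation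
invariance of the torus Wilson state, tree theorems `wilsonExpectation_comp_torusConfigShift`,
`wilsonExpectation_comp_configPerm`). [folklore] -/
theorem wilsonExpectation_plaquetteTrace_eq (hρ : Continuous ρ) (β : ℝ) {x y : Site d L}
    {i j i' j' : Fin d} (hij : i ≠ j) (hij' : i' ≠ j') :
    wilsonExpectation ρ β (plaquetteTrace ρ y i' j') = wilsonExpectation ρ β (plaquetteTrace ρ x i j) := by
  obtain ⟨π, hi, hj⟩ := exists_perm_apply_eq hij hij'
  have hi' : π.symm i = i' := by rw [← hi, Equiv.symm_apply_apply]
  have hj' : π.symm j = j' := by rw [← hj, Equiv.symm_apply_apply]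
  -- permute the axes, then translate the base point
  have h1 := wilsonExpectation_comp_configPerm (d := d) (L := L) ρ hρ β π (plaquetteTrace ρ x i j)
  have h1' : (plaquetteTrace ρ x i j ∘ configPerm π : GaugeConfig d L G → ℝ) =
      plaquetteTrace ρ (sitePerm π.symm x) i' j' := by
    funext U; simp only [Function.comp_apply, plaquetteTrace_configPerm, hi', hj']
  have h2 := wilsonExpectation_comp_torusConfigShift (d := d) (L := L) (G := G) ρ β
    (sitePerm π.symm x - y) (plaquetteTrace ρ (sitePerm π.symm x) i' j')
  have h2' : (plaquetteTrace ρ (sitePerm π.symm x) i' j' ∘ torusConfigShift (sitePerm π.symm x - y) :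
      GaugeConfig d L G → ℝ) = plaquetteTrace ρ y i' j' := by
    funext U; simp only [Function.comp_apply, plaquetteTrace_torusConfigShift, sub_sub_cancel]
  rw [h1'] at h1
  rw [h2'] at h2
  rw [h2, h1]

/-- **`⟨W_{R×T}(x; i, j)⟩` does not depend on the base point or the (ordered) pair of axes.**
[folklore] -/
theorem wilsonExpectation_wilsonLoop_eq (hρ : Continuous ρ) (β : ℝ) (R T : ℕ) {x y : Site d L}
    {i j i' j' : Fin d} (hij : i ≠ j) (hij' : i' ≠ j') :
    wilsonExpectation ρ β (wilsonLoop ρ y i' j' R T) =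
      wilsonExpectation ρ β (wilsonLoop ρ x i j R T) := by
  obtain ⟨π, hi, hj⟩ := exists_perm_apply_eq hij hij'
  have hi' : π.symm i = i' := by rw [← hi, Equiv.symm_apply_apply]
  have hj' : π.symm j = j' := by rw [← hj, Equiv.symm_apply_apply]
  have h1 := wilsonExpectation_comp_configPerm (d := d) (L := L) ρ hρ β π (wilsonLoop ρ x i j R T)
  have h1' : (wilsonLoop ρ x i j R T ∘ configPerm π : GaugeConfig d L G → ℝ) =
      wilsonLoop ρ (sitePerm π.symm x) i' j' R T := by
    funext U; simp only [Function.comp_apply, wilsonLoop_configPerm, hi', hj']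
  have h2 := wilsonExpectation_comp_torusConfigShift (d := d) (L := L) (G := G) ρ β
    (sitePerm π.symm x - y) (wilsonLoop ρ (sitePerm π.symm x) i' j' R T)
  have h2' : (wilsonLoop ρ (sitePerm π.symm x) i' j' R T ∘ torusConfigShift (sitePerm π.symm x - y) :
      GaugeConfig d L G → ℝ) = wilsonLoop ρ y i' j' R T := by
    funext U; simp only [Function.comp_apply, wilsonLoop_torusConfigShift, sub_sub_cancel]
  rw [h1'] at h1
  rw [h2'] at h2
  rw [h2, h1]

/-- **Orbit average = local expectation (A2 corollary), plaquette**: for every plaquette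
`(x, i ≠ j)` of the torus, `⟨ū_P⟩_β = ⟨u_P(x,i,j)⟩_β`. [folklore] -/
theorem wilsonExpectation_meanPlaquette_eq_plaquetteTrace (hρ : Continuous ρ) (β : ℝ) (x : Site d L)
    {i j : Fin d} (hij : i ≠ j) :
    wilsonExpectation ρ β (meanPlaquette (d := d) (L := L) (G := G) ρ) =
      wilsonExpectation ρ β (plaquetteTrace ρ x i j) := by
  haveI := isProbabilityMeasure_wilsonMeasure (d := d) (L := L) (G := G) ρ hρ β
  have hint : ∀ p : Plaquette d L, Integrable (plaquetteTrace (G := G) ρ p.1 p.2.1.1 p.2.1.2)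
      (wilsonMeasure (d := d) (L := L) ρ β) := fun p =>
    Integrable.of_bound (measurable_plaquetteTrace ρ hρ _ _ _).aestronglyMeasurable 1
      (ae_of_all _ fun U => by rw [Real.norm_eq_abs]; exact abs_plaquetteTrace_le_one ρ hρ _ _ _ U)
  have hconst : ∀ p : Plaquette d L, wilsonExpectation ρ β (plaquetteTrace (G := G) ρ p.1 p.2.1.1 p.2.1.2)
      = wilsonExpectation ρ β (plaquetteTrace ρ x i j) := fun p =>
    wilsonExpectation_plaquetteTrace_eq ρ hρ β hij (ne_of_lt p.2.2)
  -- a plaquette exists (in the plane `{i, j}`), so the average is over a nonempty set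
  have hne : Nonempty (Plaquette d L) := by
    rcases lt_or_gt_of_ne hij with h | h
    · exact ⟨(x, ⟨(i, j), h⟩)⟩
    · exact ⟨(x, ⟨(j, i), h⟩)⟩
  have hcard : (Fintype.card (Plaquette d L) : ℝ) ≠ 0 := by exact_mod_cast Fintype.card_pos.ne'
  unfold wilsonExpectation at hconst ⊢
  unfold meanPlaquette
  rw [integral_const_mul, integral_finsetSum _ fun p _ => hint p]
  simp only [hconst, Finset.sum_const, Finset.card_univ, nsmul_eq_mul]
  rw [← mul_assoc, inv_mul_cancel₀ hcard, one_mul]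

/-- **Orbit average = local expectation (A2 corollary), rectangles**: for every base point and
every ordered pair of distinct axes, `⟨W̄(R×T)⟩_β = ⟨W_{R×T}(x; i, j)⟩_β`. [folklore] -/
theorem wilsonExpectation_meanWilsonLoop_eq_wilsonLoop (hρ : Continuous ρ) (β : ℝ) (R T : ℕ)
    (x : Site d L) {i j : Fin d} (hij : i ≠ j) :
    wilsonExpectation ρ β (meanWilsonLoop (d := d) (L := L) (G := G) ρ R T) =
      wilsonExpectation ρ β (wilsonLoop ρ x i j R T) := by
  haveI := isProbabilityMeasure_wilsonMeasure (d := d) (L := L) (G := G) ρ hρ β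
  -- `|W_{R×T}| ≤ 1` (`|Re tr ρ(g)| ≤ N`, `CompactGroup.abs_re_trace_le_card`)
  have hbd : ∀ (y : Site d L) (k l : Fin d) (U : GaugeConfig d L G), |wilsonLoop ρ y k l R T U| ≤ 1 := by
    intro y k l U
    unfold wilsonLoop
    have h := CompactGroup.abs_re_trace_le_card ρ hρ (rectangleHolonomy U y k l R T)
    rw [Fintype.card_fin] at h
    rcases Nat.eq_zero_or_pos N with hN | hN
    · subst hN; simp
    · rw [abs_mul, abs_inv, Nat.abs_cast]
      calc (N : ℝ)⁻¹ * |(ρ (rectangleHolonomy U y k l R T)).trace.re| ≤ (N : ℝ)⁻¹ * N := by gcongr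
        _ = 1 := inv_mul_cancel₀ (by exact_mod_cast hN.ne')
  have hint : ∀ p : Plaquette d L, Integrable (wilsonLoop (G := G) ρ p.1 p.2.1.1 p.2.1.2 R T)
      (wilsonMeasure (d := d) (L := L) ρ β) := fun p =>
    Integrable.of_bound (StringTension.measurable_wilsonLoop ρ hρ _ _ _ R T).aestronglyMeasurable 1
      (ae_of_all _ fun U => by rw [Real.norm_eq_abs]; exact hbd _ _ _ U)
  have hconst : ∀ p : Plaquette d L,
      wilsonExpectation ρ β (wilsonLoop (G := G) ρ p.1 p.2.1.1 p.2.1.2 R T)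
      = wilsonExpectation ρ β (wilsonLoop ρ x i j R T) := fun p =>
    wilsonExpectation_wilsonLoop_eq ρ hρ β R T hij (ne_of_lt p.2.2)
  have hne : Nonempty (Plaquette d L) := by
    rcases lt_or_gt_of_ne hij with h | h
    · exact ⟨(x, ⟨(i, j), h⟩)⟩
    · exact ⟨(x, ⟨(j, i), h⟩)⟩
  have hcard : (Fintype.card (Plaquette d L) : ℝ) ≠ 0 := by exact_mod_cast Fintype.card_pos.ne'
  unfold wilsonExpectation at hconst ⊢
  unfold meanWilsonLoop
  rw [integral_const_mul, integral_finsetSum _ fun p _ => hint p]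
  simp only [hconst, Finset.sum_const, Finset.card_univ, nsmul_eq_mul]
  rw [← mul_assoc, inv_mul_cancel₀ hcard, one_mul]

/-- **Reflection invariance, every torus side `L`.** The Wilson expectation is invariant under the
site reflection `Θ' : x₀ ↦ -x₀` of configurations (`GaugeConfig.negReflect`): product Haar measure is
`Θ'`-invariant (tree `WilsonSiteRP.measurePreserving_negReflect`) and so is the Wilson action (`Θ'`
permutes the plaquettes up to inversion of the holonomy, tree `WilsonSiteRP.plaqRe_negReflect`; cf. the
even-`L` packaging `WilsonSiteRP.wilsonMeasure_map_negReflect` of `WilsonSiteRPForm`). With translations and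
axis permutations this generates the invariance under translations ⋉ `B_d` needed for reflection-positivity
blocks in every axis and position (SCOPING A2). [folklore] -/
theorem wilsonExpectation_comp_negReflect [NeZero d] (hρ : Continuous ρ) (β : ℝ) {V : Type*}
    [NormedAddCommGroup V] [NormedSpace ℝ V] (F : GaugeConfig d L G → V) :
    wilsonExpectation ρ β (F ∘ GaugeConfig.negReflect) = wilsonExpectation ρ β F := by
  -- the action is `Θ'`-invariant on every torus
  have hS : ∀ U : GaugeConfig d L G, wilsonAction ρ U.negReflect = wilsonAction ρ U := fun U => by
    rw [WilsonRP.wilsonAction_eq, WilsonRP.wilsonAction_eq]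
    simp_rw [WilsonSiteRP.plaqRe_negReflect ρ hρ U]
    congr 1
    exact Equiv.sum_comp WilsonSiteRP.sitePlaqReflectEquiv (WilsonRP.plaqRe ρ U)
  -- hence so is the Wilson measure
  have hμ : (wilsonMeasure (d := d) (L := L) ρ β).map
      (WilsonSiteRP.negReflectEquiv (d := d) (L := L) (G := G)) = wilsonMeasure ρ β := by
    have hbase : (Measure.pi fun _ : Edge d L => haarProbability G).map
        (WilsonSiteRP.negReflectEquiv (d := d) (L := L) (G := G)) = Measure.pi fun _ => haarProbability G :=
      (WilsonSiteRP.measurePreserving_negReflect (d := d) (L := L) (G := G)).map_eq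
    have hw := WilsonGauge.withDensity_map_equiv_of_invariant
      (Measure.pi fun _ : Edge d L => haarProbability G) WilsonSiteRP.negReflectEquiv
      (fun U => ENNReal.ofReal (Real.exp (-β * wilsonAction ρ U))) hbase
      (fun U => by
        show ENNReal.ofReal (Real.exp (-β * wilsonAction ρ (GaugeConfig.negReflect U))) = _
        rw [hS])
    unfold wilsonMeasure
    rw [Measure.map_smul]
    exact congrArg _ hw
  have h := MeasureTheory.integral_map_equiv (WilsonSiteRP.negReflectEquiv (d := d) (L := L) (G := G))
    (μ := wilsonMeasure ρ β) F
  rw [hμ] at h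
  exact h.symm

end Symmetry

section Targets

variable {N D L₀ : ℕ} {β a b : ℝ}

/-- **Local form**: a certified window for the orbit average `ū_P` is a window for the expectation of
every single plaquette `u_P(x, i, j)`, `i ≠ j`, of every even torus `L ≥ L₀` (A2 corollary). -/
theorem PlaquetteWindow.plaquetteTrace_mem (h : PlaquetteWindow N D L₀ β a b) (L : ℕ) [NeZero L]
    (hL : Even L) (hL₀ : L₀ ≤ L) (x : Site D L) {i j : Fin D} (hij : i ≠ j) :
    a ≤ wilsonExpectation (suRep N) (β / N) (plaquetteTrace (suRep N) x i j) ∧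
      wilsonExpectation (suRep N) (β / N) (plaquetteTrace (suRep N) x i j) ≤ b := by
  rw [← wilsonExpectation_meanPlaquette_eq_plaquetteTrace (suRep N) (continuous_suRep N) _ x hij]
  exact h L hL hL₀

/-- **Local form, rectangles**: a certified `W̄(R×T)` window bounds `⟨W_{R×T}(x; i, j)⟩` for every
base point and ordered pair of distinct axes. -/
theorem WilsonLoopWindow.wilsonLoop_mem {R T : ℕ} (h : WilsonLoopWindow N D L₀ β R T a b) (L : ℕ)
    [NeZero L] (hL : Even L) (hL₀ : L₀ ≤ L) (x : Site D L) {i j : Fin D} (hij : i ≠ j) :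
    a ≤ wilsonExpectation (suRep N) (β / N) (wilsonLoop (suRep N) x i j R T) ∧
      wilsonExpectation (suRep N) (β / N) (wilsonLoop (suRep N) x i j R T) ≤ b := by
  rw [← wilsonExpectation_meanWilsonLoop_eq_wilsonLoop (suRep N) (continuous_suRep N) _ R T x hij]
  exact h L hL hL₀

end Targets

end Summit.QuantumFields.GaugeBoot

end
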